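import Literature.MathematicalPhysics.QuantumFieldTheory.Balaban1983to89.B8Prop7GlevZd3
import Literature.MathematicalPhysics.QuantumFieldTheory.Balaban1983to89.B8Thm4TruncationLocal

/-!
# `Balaban1983to89.B8Prop7TowerAxialZd3` — [Balaban1985RegularSpaces] **Proposition 7** (Sect. G, p. 100): PRINT'S AXIAL GAUGE MAP
# «u satisfying (1.29) such that U′ = (U₁U₀)^u U₀⁻¹ satisfies the axial gauge conditions (1.19)» AT A GENERAL MEMBER of NODE 00's
# carrier `B8LeafModelZd3.zdGF3` (towers of several heights): the TOWER-WISE gauge fixing `uTower` — [3]'s `glev` of depth `J(x)` at each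
# site `x`, `J(x)` = the level of the DEEPEST listed tower containing `x` — its well-definedness on the tree's indices WITHOUT a new index law
# (towers are `L`-adic blocks, hence nested-or-disjoint), and the `Ax_m(𝔅_m, U₀)`-clause of (1.144) for `(U₁U₀)^{uTower}` at EVERY
# truncation `m ≤ k` of EVERY member obeying NODE 00's located index law №8 (pure algebra, no smallness)

statement-level skeleton of published theorems with citation tags; proofs where landed; nothing here is a claim about the Yang–Mills mass gap

T. Bałaban, *Spaces of regular gauge field configurations on a lattice and gauge fixing conditions*, Commun. Math. Phys. **99** (1985) 75–102
`[Balaban1985RegularSpaces]` ("B8"; journal page = PDF page + 74; PDF held `paper:balaban1985-cmp99-regular-spaces-gauge-fixing`): Prop. 7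
(1.144)–(1.145) p. 100, (1.19)–(1.20) p. 79, (1.29) p. 81, (1.5)–(1.6) p. 77.  [3] = T. Bałaban, *Averaging operations for lattice gauge
theories*, Commun. Math. Phys. **98** (1985) 17–51 `[Balaban1985Averaging]`: (67) p. 29, (70)–(71) p. 29, (76)–(77) pp. 29–30, (87) p. 31.

## THE PRINTED TEXT (p. 100 [PDF 26], verbatim)

*"Let us take a gauge transformation u satisfying the conditions (1.29) and such that the configuration U′ = (U₁U₀)^u U₀⁻¹ satisfies
the axial gauge conditions (1.19). This gauge transformation is determined uniquely."* — and p. 77: *"Λ_j = Ω_j^{(j)} ∖ Ω_{j+1}^{(j)} (1.5)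
… ⋃_j B^j(Λ_j) = T_η (1.6)"*; p. 79 (1.19): the axial gauge conditions hold *"for x₀ ∈ B^j(x_j), x_j ∈ Λ_j, 1 ≤ j ≤ k"* along the chain
*"x_n ∈ B(x_{n+1}), n = 0, 1, …, j − 1"* — i.e. INSIDE EACH TOWER `B^j(x_j)` SEPARATELY, with `u` on that tower [3]'s gauge fixing of DEPTH `j`
((76)–(77), (87) of [3], p. 81 «In [3] we have determined the gauge transformation u in terms of the configuration U₁»).

## WHY THIS FILE (cell `pub-ymgap`, HUMAN RULING D-0062; R134 seat `pub-ymgap-dag-n05-c` g6, DAG node N05 = [B8]; count-neutral)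

After the [B8″H] pin (`Node00/CarriersB8SubBH`, this seat g6) and dag-n05-d's re-keyed knit faces, the N05 knit displays ONE printed member
of [Balaban1985RegularSpaces] as a hypothesis: `p7 : B8SectGH.Prop7PrintedR (famB8OfRecordSubB θ …) (fun j => λ.toAxial j.1)`, whose axial
map `λ.toAxial` is FREE residual data — junk-dischargeable (this seat g4, `B8Prop7GlevZd3` (K1) ∕ `Thm/BalabanUVNodesN05Prop7UnitAxial`), and
ref-E's standing condition (READ-18, 2026-08-27): «a p7-discharge counts only with `toAxial` pinned to print's map».  g4's `toAxialGlev`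
([3]'s GLOBAL gauge fixing of depth `k`) is print's map only on the all-`ℤᵈ` members; at a member with towers of several heights print's `u`
is TOWER-WISE (LOCATED (b) of `B8Prop7GlevZd3`: outside `Ω_k` the depth-`k` block frames are not small, the global `glev … k 0` is not even
unitary-valued there).  LOCATED (b) also said the tower-wise map «wants the towers pairwise DISJOINT — print's (1.5) — a law the indices do
not carry».  THIS FILE REMOVES THAT OBSTRUCTION: the listed towers `Bʲ(y)`, `y ∈ Λs k j`, are `L`-adic blocks, and two `L`-adic blocks through
a common site are NESTED (§1 `under_nested`); so «the level of the DEEPEST listed tower containing `x`» (§2 `towerDepth`) is well defined at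
every member, CONSTANT on every listed tower (§2 `towerDepth_eq_of_under`), and equal to print's (1.5) depth on the members whose towers
partition.  The map (§3) `uTower x := glev_{towerDepth x}(x)` on the cover, `:= 1` off it, is therefore [3]'s depth-`J` gauge fixing on every
maximal listed tower of level `J` — print's `u` — and the axial gauge conditions (1.19) for `(U₁U₀)^{uTower}` hold INSIDE EVERY LISTED TOWER
(§3 `inAx_uTower_top`): the condition (67) of [3] at `(n, z, r)` reads the gauge function only at the two sites `Lⁿ⁺¹z`, `Lⁿ(Lz + r)` of the
`(n+1)`-block `z` ([3] (70)–(71): `B7Eq92Concrete.tildIter_mgauge`, `tHol_mgauge` — §3 `axialCond_congr`), both inside the tower, where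
`uTower = glev_J` with `J ≥ j > n`, and `glev_J` is axial on EVERY `n`-block, `n < J` (`B7Eq84Concrete.axialGauge_glev`).  By NODE 00's
located law №8 (`B8Thm4TruncationLocal.inAx_truncate`) the clause descends to every truncation `m ≤ k` (§3 `inAx_uTower_all`).  §4 reads this at
the carrier: `toAxialTower` (the `Pert`-valued map, totalised on the unitarity of `uTower` exactly as g4's `toAxialGlev`) and
`inAAx_toAxialTower` — THE WHOLE (1.144)-CLAUSE of Proposition 7's conclusion for print's map at every law member with `Ω₀ = ℤᵈ`, wherever
`uTower` is unitary-valued (the `𝔄_k`-clause by g4's `inAk_gaugeAct_of_c140`).  NO (1.29): the typed `Prop7PrintedR` ∕ `Prop7RepairedC` do not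
ask `Restricted`, and at a member whose listed towers OVER-cover (a cover, not print's partition) print's (1.29) over-determines `u`
(`B7Eq84Concrete.eq81_glev` normalises the depth-`J` fixing at level `J` only) — the reason the honest map keys on the DEEPEST tower.

NOT IN THIS FILE (the next bricks of the honest `p7`, species word pending — bus P7 SPECIES NOTE 2026-08-27): (i) `uTower` IS unitary-valued
under (1.139)∕(1.140) (r05 g7's `B8Prop7AdmittedFamily.glev_mem_unitaryUnits` LOCALISED to a tower by `B7Prop1Local.clampCfg` ∕
`avgIter_congr`); (ii) the (1.145)-half in `zdGF3`'s box form with a constant `C(d)` (r05 g7's `norm_avgIter_fixed_sub_le_all` localised +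
the inter-tower jumps); (iii) the leaf-level species (`Prop7RepairedC C(d)` with `toAxial := toAxialTower`, or a re-typed domain).

## HONEST SCOPE

Definitions + algebra BY NAME ([3] (67) ∕ (70)–(71) ∕ (76)–(77) ∕ (87): `axialGauge_glev`, `tildIter_mgauge`, `tHol_mgauge`; NODE 00 law №8:
`inAx_truncate`); NO estimate of [Balaban1985RegularSpaces] or [3] is proved anew or asserted; `toAxialTower` off the unitarity regime is junk
by construction (the `else` branch), exactly as `toAxialGlev`; nothing of (1.145) is touched; the leaf is NOT re-typed and NO species is chosen
here.  Count-neutral; N05 NOT discharged; `T_η ↦ ℤᵈ` carriers, `G = U(𝔸)`; one finite `T⁴` programme at fixed `ε`, Bałaban as printed —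
nothing continuum ∕ ℝ⁴ ∕ OS ∕ mass-gap ∕ Clay.  No `sorry`, no `axiom`, no `instance`, no `notation`.  Unit `pub-ymgap-dag-n05-c` (g6), 2026-08-27.

[cite: Balaban1985RegularSpaces, Prop. 7 (1.144) p.100, (1.19)–(1.20) p.79, (1.29) p.81, (1.5)–(1.6) p.77, (1.34) p.82;
Balaban1985Averaging, (67) p.29, (70)–(71) p.29, (76)–(77) pp.29–30, (87) p.31]
-/

noncomputable section

open NormedSpace

namespace Literature.MathematicalPhysics.QuantumFieldTheory.Balaban1983to89.B8Prop7TowerAxialZd3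

open B7Prop1Explicit B7Prop2Explicit B7Eq92Concrete B7Eq84Concrete
open B7AvgGaugeCovariance (uLev)
open B8Ineq132 (InAk Under)
open B8Eq119TwistedAxial (InAx)
open B8Eq131Derivation (ax119_iff_ax67 under_succ_of_under_block under_one_block)
open B8Eq131Cubes (flm under_flm)
open B8Lemma1NonAbelian (mulCfg)
open B8Thm4Concrete (mulCfg_eq_mul)
open B8Prop7AdmittedFamily (mgauge_mul_eq_gaugeAct_mulCfg)
open B8Prop7GlevZd3 (unitPert inAk_gaugeAct_of_c140 mgauge_mem_unitaryUnits)
open B8Thm4TruncationLocal (inAx_truncate)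
open B8LeafModelZd (ZdIdx)
open B8LeafModelZd3 (zdGF3)

-- `Site` alone could resolve to the torus sites of `Setup.lean`; re-export the `ℤ^d` sites of `B7Prop1Explicit`.
export B7Prop1Explicit (Site)

variable {d : ℕ}

/-! ## §1 `L`-adic blocks through a common site are nested (the floor maps compose) -/

section Blocks

variable {L : ℕ}

/-- `x ∈ Bᵐ(z)` determines `z`: it is the `Lᵐ`-floor of `x`. [cite: Balaban1985RegularSpaces, (1.6) p.77 (bookkeeping: the blocks of the lattice)] -/
theorem flm_eq_of_under (hL : 1 ≤ L) {m : ℕ} {z x : Site d} (hx : Under L m z x) : flm L m x = z := by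
  funext i
  obtain ⟨h1, h2⟩ := hx i
  have hpos : (0 : ℤ) < (L : ℤ) ^ m := by positivity
  simp only [flm]
  have hlo : z i ≤ x i / (L : ℤ) ^ m := by
    rw [Int.le_ediv_iff_mul_le hpos]; linarith
  have hhi : x i / (L : ℤ) ^ m < z i + 1 := by
    rw [Int.ediv_lt_iff_lt_mul hpos]; linarith
  omega

/-- `x ∈ Bᵐ(z) ⇔ ⌊x∕Lᵐ⌋ = z`. [cite: Balaban1985RegularSpaces, (1.6) p.77 (bookkeeping)] -/
theorem under_iff_flm_eq (hL : 1 ≤ L) (m : ℕ) (z x : Site d) : Under L m z x ↔ flm L m x = z :=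
  ⟨flm_eq_of_under hL, fun h => h ▸ under_flm hL m x⟩

/-- The floor maps compose: `⌊⌊x∕Lᵐ⌋∕Lⁿ⌋ = ⌊x∕L^{m+n}⌋` (private plumbing). [folklore] -/
private theorem flm_flm (L : ℕ) (m n : ℕ) (x : Site d) : flm L n (flm L m x) = flm L (m + n) x := by
  funext i
  simp only [flm]
  rw [Int.ediv_ediv_of_nonneg (by positivity : (0 : ℤ) ≤ (L : ℤ) ^ m), pow_add]

/-- Composition of depths: `x ∈ Bᵐ(z)`, `z ∈ Bⁿ(y)` ⇒ `x ∈ B^{m+n}(y)`. [cite: Balaban1985RegularSpaces, p.79 («x_n ∈ B(x_{n+1})», iterated)] -/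
theorem under_comp (hL : 1 ≤ L) {m n : ℕ} {y z x : Site d} (hz : Under L n y z) (hx : Under L m z x) : Under L (m + n) y x := by
  rw [under_iff_flm_eq hL] at hz hx ⊢
  rw [← flm_flm, hx, hz]

/-- **Two `L`-adic blocks through a common site are NESTED**: if `x ∈ Bʲ(y)` and `x ∈ Bᴶ(y′)` with `j ≤ J`, then `Bʲ(y) ⊂ Bᴶ(y′)`.  This is why «the
deepest listed tower containing a site» is well defined on a COVER and needs no disjointness law. [cite: Balaban1985RegularSpaces, (1.5)–(1.6) p.77 (bookkeeping: towers are blocks)] -/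
theorem under_nested (hL : 1 ≤ L) {j J : ℕ} (hjJ : j ≤ J) {y y' x : Site d} (hy : Under L j y x) (hy' : Under L J y' x) {x' : Site d}
    (hx' : Under L j y x') : Under L J y' x' := by
  obtain ⟨n, rfl⟩ := Nat.exists_eq_add_of_le hjJ
  rw [under_iff_flm_eq hL] at hy hy' hx' ⊢
  rw [← flm_flm] at hy' ⊢
  rw [hx', ← hy, hy']

/-- The lower corner `Lᵐz` of the block `Bᵐ(z)` lies in it (`L ≥ 1`). [cite: Balaban1985RegularSpaces, (1.6) p.77 (bookkeeping)] -/
theorem under_smul_self (hL : 1 ≤ L) (m : ℕ) (z : Site d) : Under L m z (((L : ℤ) ^ m) • z) := by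
  intro i
  have h1 : (1 : ℤ) ≤ (L : ℤ) ^ m := by exact_mod_cast Nat.one_le_pow m L hL
  simp only [Pi.smul_apply, smul_eq_mul]
  constructor
  · exact le_rfl
  · rw [mul_add, mul_one]; linarith

end Blocks

/-! ## §2 The DEPTH of a site under a tower family: the level of the deepest listed tower containing it -/

section Depth

open Classical

variable (L k : ℕ) (Λ : ℕ → Set (Site d))

/-- `x` lies in some listed tower of level `j`: `∃ y ∈ Λ_j, x ∈ Bʲ(y)`. [cite: Balaban1985RegularSpaces, (1.6) p.77] -/
def InTower (j : ℕ) (x : Site d) : Prop := ∃ y ∈ Λ j, Under L j y x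

/-- `x` is COVERED by the listed towers of levels `≤ k` ((1.6): every site of `Ω₀` is). [cite: Balaban1985RegularSpaces, (1.6) p.77] -/
def Covered (x : Site d) : Prop := ∃ j, j ≤ k ∧ InTower L Λ j x

/-- **THE DEPTH OF A SITE**: the LARGEST level `J ≤ k` such that `x` lies in a listed tower of level `J` (`0` if none) — on the members whose
towers partition `Ω₀` this is print's (1.5) level «x ∈ Bʲ(Λ_j), Λ_j = Ω_j^{(j)} ∖ Ω_{j+1}^{(j)}». [cite: Balaban1985RegularSpaces, (1.5)–(1.6) p.77] -/
def towerDepth (x : Site d) : ℕ := Nat.findGreatest (fun j => InTower L Λ j x) k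

variable {L k Λ}

/-- The depth is at most `k`. [cite: Balaban1985RegularSpaces, (1.5) p.77 (bookkeeping)] -/
theorem towerDepth_le (x : Site d) : towerDepth L k Λ x ≤ k := Nat.findGreatest_le (P := fun j => InTower L Λ j x) _

/-- A listed tower of level `j ≤ k` through `x` bounds the depth from below. [cite: Balaban1985RegularSpaces, (1.5) p.77 (bookkeeping)] -/
theorem le_towerDepth {j : ℕ} (hj : j ≤ k) {x : Site d} (hx : InTower L Λ j x) : j ≤ towerDepth L k Λ x :=
  Nat.le_findGreatest (P := fun j => InTower L Λ j x) hj hx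

/-- A covered site lies in a listed tower of its own depth. [cite: Balaban1985RegularSpaces, (1.5)–(1.6) p.77 (bookkeeping)] -/
theorem inTower_towerDepth {x : Site d} (hx : Covered L k Λ x) : InTower L Λ (towerDepth L k Λ x) x := by
  obtain ⟨j, hj, hjx⟩ := hx
  exact Nat.findGreatest_spec (P := fun j => InTower L Λ j x) hj hjx

/-- No listed tower of a level above the depth (and `≤ k`) contains the site. [cite: Balaban1985RegularSpaces, (1.5) p.77 (bookkeeping)] -/
theorem not_inTower_of_towerDepth_lt {x : Site d} {J : ℕ} (hJ : towerDepth L k Λ x < J) (hJk : J ≤ k) : ¬ InTower L Λ J x :=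
  Nat.findGreatest_is_greatest (P := fun j => InTower L Λ j x) hJ hJk

/-- **THE DEPTH IS CONSTANT ON EVERY LISTED TOWER** (`L ≥ 1`): two sites of one listed tower `Bʲ(y)`, `y ∈ Λ_j`, `j ≤ k`, have the same depth —
above level `j` the listed towers containing them are the same (nestedness, `under_nested`), and both depths are `≥ j`.
[cite: Balaban1985RegularSpaces, (1.5)–(1.6) p.77 (bookkeeping: the deepest tower is constant on towers)] -/
theorem towerDepth_eq_of_under (hL : 1 ≤ L) {j : ℕ} (hj : j ≤ k) {y : Site d} (hy : y ∈ Λ j) {x x' : Site d} (hx : Under L j y x)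
    (hx' : Under L j y x') : towerDepth L k Λ x = towerDepth L k Λ x' := by
  -- one inequality suffices by symmetry
  suffices h : ∀ {a b : Site d}, Under L j y a → Under L j y b → towerDepth L k Λ a ≤ towerDepth L k Λ b from
    le_antisymm (h hx hx') (h hx' hx)
  intro a b ha hb
  have hja : j ≤ towerDepth L k Λ a := le_towerDepth hj ⟨y, hy, ha⟩
  obtain ⟨y', hy', hy'a⟩ := inTower_towerDepth (L := L) (k := k) (Λ := Λ) ⟨j, hj, y, hy, ha⟩
  -- the deepest tower through `a` has level `≥ j`, hence contains the whole tower `Bʲ(y)`, in particular `b`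
  exact le_towerDepth (towerDepth_le a) ⟨y', hy', under_nested hL hja ha hy'a hb⟩

/-- A site of a listed tower of level `j ≤ k` is covered. [cite: Balaban1985RegularSpaces, (1.6) p.77 (bookkeeping)] -/
theorem covered_of_under {j : ℕ} (hj : j ≤ k) {y : Site d} (hy : y ∈ Λ j) {x : Site d} (hx : Under L j y x) : Covered L k Λ x :=
  ⟨j, hj, y, hy, hx⟩

/-- **On a MAXIMAL listed tower the depth is the tower's own level**: if no listed tower of a higher level `≤ k` passes through `x ∈ Bʲ(y)`,
`y ∈ Λ_j`, then `towerDepth x = j` — on the members whose listed towers PARTITION (print's (1.5)) every listed tower is maximal, so the depth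
IS print's level. [cite: Balaban1985RegularSpaces, (1.5) p.77 («Λ_j = Ω_j^{(j)} ∖ Ω_{j+1}^{(j)}»)] -/
theorem towerDepth_eq_of_maximal {j : ℕ} (hj : j ≤ k) {y : Site d} (hy : y ∈ Λ j) {x : Site d} (hx : Under L j y x)
    (hmax : ∀ J, j < J → J ≤ k → ¬ InTower L Λ J x) : towerDepth L k Λ x = j := by
  refine le_antisymm ?_ (le_towerDepth hj ⟨y, hy, hx⟩)
  by_contra hlt
  exact hmax _ (lt_of_not_ge hlt) (towerDepth_le x) (inTower_towerDepth (covered_of_under hj hy hx))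

/-- **The all-`ℤᵈ` family of record** (`B8Prop7AdmittedFamily.LamTop k`: `Λ_k = ℤᵈ`, `Λ_j = ∅` below): every site is covered and has depth `k`.
[cite: Balaban1985RegularSpaces, p.77 («we admit Ω_j = T_η»), (1.5) p.77] -/
theorem towerDepth_lamTop (hL : 1 ≤ L) (x : Site d) :
    Covered L k (B8Prop7AdmittedFamily.LamTop k) x ∧ towerDepth L k (B8Prop7AdmittedFamily.LamTop k) x = k := by
  have hx : InTower L (B8Prop7AdmittedFamily.LamTop (d := d) k) k x :=
    ⟨flm L k x, by simp [B8Prop7AdmittedFamily.LamTop], under_flm hL k x⟩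
  exact ⟨⟨k, le_rfl, hx⟩, le_antisymm (towerDepth_le x) (le_towerDepth le_rfl hx)⟩

end Depth

/-! ## §3 The tower-wise gauge fixing `uTower`; two-site locality of (67); the axial clause inside every listed tower and at every truncation -/

section Tower

variable {𝔸 : Type*} [NormedRing 𝔸] [NormedAlgebra ℂ 𝔸] [CompleteSpace 𝔸]

variable (L : ℕ) (hL : 1 ≤ L) (k : ℕ) (Λ : ℕ → Set (Site d)) (U₀ U₁ : Site d → Fin d → 𝔸ˣ)

open Classical in
/-- **PRINT'S GAUGE TRANSFORMATION `u` OF PROPOSITION 7 AT A GENERAL MEMBER** — [3]'s gauge fixing ((76)–(77), (87): `B7Eq84Concrete.glev`) of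
DEPTH `towerDepth x` read at the site `x` (so: the depth-`J` fixing on every maximal listed tower of level `J`), and `1` off the cover (off `Ω₀`
at a law member).  On the members whose listed towers partition this IS print's tower-wise `u` («determined uniquely», p. 100).
[cite: Balaban1985RegularSpaces, Prop. 7 p.100 («a gauge transformation u … such that U′ satisfies (1.19)»), (1.19) p.79, p.81 («In [3] we have determined the gauge transformation u»); Balaban1985Averaging, (76)–(77) pp.29–30, (87) p.31] -/
def uTower (x : Site d) : 𝔸ˣ :=
  if Covered L k Λ x then glev L hL U₀ U₁ (towerDepth L k Λ x) 0 x else 1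

variable {L hL k Λ U₀ U₁}

/-- Off the cover `uTower = 1`. [cite: Balaban1985RegularSpaces, (1.28) p.81 («u = 1» outside), (1.6) p.77] -/
theorem uTower_of_not_covered {x : Site d} (hx : ¬ Covered L k Λ x) : uTower L hL k Λ U₀ U₁ x = 1 := by
  rw [uTower, if_neg hx]

/-- On the cover `uTower x = glev_{towerDepth x}(x)`. [cite: Balaban1985Averaging, (76)–(77) pp.29–30, (87) p.31] -/
theorem uTower_of_covered {x : Site d} (hx : Covered L k Λ x) : uTower L hL k Λ U₀ U₁ x = glev L hL U₀ U₁ (towerDepth L k Λ x) 0 x := by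
  rw [uTower, if_pos hx]

/-- **On a listed tower `Bʲ(y)`, `y ∈ Λ_j`, `uTower` is [3]'s gauge fixing of ONE depth `J = towerDepth` (constant on the tower, `J ≥ j`).**
[cite: Balaban1985RegularSpaces, p.100, (1.19) p.79; Balaban1985Averaging, (76)–(77) pp.29–30, (87) p.31] -/
theorem uTower_of_under {j : ℕ} (hj : j ≤ k) {y : Site d} (hy : y ∈ Λ j) {x₀ x : Site d} (hx₀ : Under L j y x₀) (hx : Under L j y x) :
    uTower L hL k Λ U₀ U₁ x = glev L hL U₀ U₁ (towerDepth L k Λ x₀) 0 x := by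
  rw [uTower_of_covered (covered_of_under hj hy hx), towerDepth_eq_of_under hL hj hy hx hx₀]

/-- **On a MAXIMAL listed tower `Bʲ(y)` the map IS [3]'s gauge fixing of the tower's own depth `j`** — print's tower-wise `u` on the members
whose towers partition. [cite: Balaban1985RegularSpaces, Prop. 7 p.100 («determined uniquely»), (1.5) p.77; Balaban1985Averaging, (76)–(77) pp.29–30, (87) p.31] -/
theorem uTower_of_maximal {j : ℕ} (hj : j ≤ k) {y : Site d} (hy : y ∈ Λ j) {x : Site d} (hx : Under L j y x)
    (hmax : ∀ J, j < J → J ≤ k → ¬ InTower L Λ J x) : uTower L hL k Λ U₀ U₁ x = glev L hL U₀ U₁ j 0 x := by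
  rw [uTower_of_covered (covered_of_under hj hy hx), towerDepth_eq_of_maximal hj hy hx hmax]

/-- **On the all-`ℤᵈ` family of record the tower map IS [3]'s GLOBAL depth-`k` gauge fixing** `glev … k 0` — g4's `toAxialGlev` ∕ lit-balaban
r05 g7's `toAxialGF` (so everything certified for them there — `prop7_zdGF3_univ_explicit`, `prop7RepairedC_zdGF3_univ` — is about THIS map on
those members). [cite: Balaban1985RegularSpaces, p.77 («we admit Ω_j = T_η»), Prop. 7 p.100; Balaban1985Averaging, (87) p.31] -/
theorem uTower_lamTop : uTower L hL k (B8Prop7AdmittedFamily.LamTop k) U₀ U₁ = glev L hL U₀ U₁ k 0 := by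
  funext x
  obtain ⟨hc, hk⟩ := towerDepth_lamTop (k := k) hL x
  rw [uTower_of_covered hc, hk]

/-- If every site of `Ω₀` is covered by a listed tower (NODE 00's index law (1.6), `hpart`) then `uTower = 1` exactly off `Ω₀` — i.e. `uTower` is
carried by `Ω₀` whenever the towers lie in `Ω₀`. [cite: Balaban1985RegularSpaces, (1.6) p.77, (1.28) p.81] -/
theorem uTower_eq_one_off {Ω₀ : Set (Site d)} (htower : ∀ j, j ≤ k → ∀ y ∈ Λ j, ∀ x, Under L j y x → x ∈ Ω₀) {x : Site d} (hx : x ∉ Ω₀) :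
    uTower L hL k Λ U₀ U₁ x = 1 :=
  uTower_of_not_covered fun ⟨j, hj, y, hy, hyx⟩ => hx (htower j hj y hy x hyx)

/-- **TWO-SITE LOCALITY OF THE AXIAL CONDITION (67) of [3] IN THE GAUGE FUNCTION** ([3] (70)–(71): `Ũ′ʲ = (Ũ₁^u)ʲ_b = u(b₋)(Ũ₁)ʲ_b R̄ʲ_{0,b}
u⁻¹(b₊)`): the block-contour condition `(R̄ⁿ_{0,y}Ũ′ⁿ)(Γ) = 1` at `(n, y, Γ)` for `U′ = U₁^{u}` reads `u` only at the fine sites `Lⁿy` and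
`Lⁿ(y + disp Γ)`; two gauge functions agreeing there give the same condition. [cite: Balaban1985Averaging, (67) p.29, (70)–(71) p.29] -/
theorem tHol_tildIter_mgauge_congr {u u' : Site d → 𝔸ˣ} (n : ℕ) (y : Site d) (w : List (Letter d))
    (h1 : uLev L u n y = uLev L u' n y) (h2 : uLev L u n (y + disp w) = uLev L u' n (y + disp w)) :
    tHol (avgIter L U₀ n) (tildIter L U₀ (mgauge U₀ u U₁) n) y w = tHol (avgIter L U₀ n) (tildIter L U₀ (mgauge U₀ u' U₁) n) y w := by
  rw [tildIter_mgauge, tildIter_mgauge, tHol_mgauge, tHol_mgauge, h1, h2]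

/-- **`(U₁U₀)^{uTower}` SATISFIES THE AXIAL GAUGE CONDITIONS (1.19) INSIDE EVERY LISTED TOWER** — `InAx L k Λ U₀ ((U₁U₀)^{uTower})` for the
full listed family `Λ = Λs k` (every `U₀`, `U₁`; `L ≥ 1`; no smallness): at `(j, x_j, n < j, z, r)` the condition reads `uTower` at two sites of
the `(n+1)`-block `z ⊂ Bʲ(x_j)` (`tHol_tildIter_mgauge_congr`), where `uTower = glev_J`, `J = towerDepth ≥ j > n` constant on the tower
(`uTower_of_under`), and `glev_J` is axial on every `n`-block (`B7Eq84Concrete.axialGauge_glev`).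
[cite: Balaban1985RegularSpaces, (1.19) p.79, Prop. 7 (1.144) p.100 («∩ Ax_k(𝔅_k, U₀)»); Balaban1985Averaging, (67) p.29, (76)–(77) pp.29–30] -/
theorem inAx_uTower_top : InAx L k Λ U₀ (mgauge U₀ (uTower L hL k Λ U₀ U₁) U₁ * U₀) := by
  intro j _ hjk xj hxj n hn z hz r
  rw [ax119_iff_ax67]
  -- the two sites read by the condition, both in the tower `Bʲ(x_j)`
  set J := towerDepth L k Λ (((L : ℤ) ^ (n + 1)) • z) with hJ
  have hz₁ : Under L j xj (((L : ℤ) ^ (n + 1)) • z) := by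
    have h := under_comp hL hz (under_smul_self hL (n + 1) z)
    rwa [show n + 1 + (j - (n + 1)) = j by omega] at h
  have hz₂ : Under L j xj (((L : ℤ) ^ n) • ((L : ℤ) • z + boxVec L r)) := by
    have h1 : Under L (n + 1) z (((L : ℤ) ^ n) • ((L : ℤ) • z + boxVec L r)) := by
      exact under_comp hL (under_one_block L z r) (under_smul_self hL n ((L : ℤ) • z + boxVec L r))
    have h := under_comp hL hz h1
    rwa [show n + 1 + (j - (n + 1)) = j by omega] at h
  have hjJ : j ≤ J := le_towerDepth hjk ⟨xj, hxj, hz₁⟩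
  have e₁ : uLev L (uTower L hL k Λ U₀ U₁) n ((L : ℤ) • z) = uLev L (glev L hL U₀ U₁ J 0) n ((L : ℤ) • z) := by
    show uTower L hL k Λ U₀ U₁ (((L : ℤ) ^ n) • ((L : ℤ) • z)) = glev L hL U₀ U₁ J 0 (((L : ℤ) ^ n) • ((L : ℤ) • z))
    rw [smul_smul, ← pow_succ]
    exact uTower_of_under hjk hxj hz₁ hz₁
  have e₂ : uLev L (uTower L hL k Λ U₀ U₁) n ((L : ℤ) • z + disp (treeWord (boxVec L r))) =
      uLev L (glev L hL U₀ U₁ J 0) n ((L : ℤ) • z + disp (treeWord (boxVec L r))) := by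
    rw [disp_treeWord]
    exact uTower_of_under hjk hxj hz₁ hz₂
  rw [tHol_tildIter_mgauge_congr n _ _ e₁ e₂]
  exact axialGauge_glev L hL U₀ U₁ J n (by omega) z r

/-- **… AND AT EVERY TRUNCATION `m ≤ k`** of a member obeying NODE 00's located index law №8 (`Λs m j = Λs (m+1) j` for `j < m`, `Λs m m =
Λs (m+1) m ∪ B(Λs (m+1) (m+1))`): `InAx L m (Λs m) U₀ ((U₁U₀)^{uTower})` for `uTower` built on the full family `Λs k`, by downward induction
with `B8Thm4TruncationLocal.inAx_truncate` («they imply the same conditions for k − 1», p. 88). [cite: Balaban1985RegularSpaces, (1.19) p.79, (1.34) p.82, p.88 («the same conditions for k − 1»), p.89 («Λ_{k−1} ∪ B(Λ_k)»)] -/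
theorem inAx_uTower_all {Λs : ℕ → ℕ → Set (Site d)} (hlt : ∀ m, m < k → ∀ j, j < m → Λs m j = Λs (m + 1) j)
    (htop : ∀ m, m < k → ∀ x, x ∈ Λs m m ↔ x ∈ Λs (m + 1) m ∨ ∃ y ∈ Λs (m + 1) (m + 1), x ∈ Literature.MathematicalPhysics.QuantumLattice.blockSites L y) :
    ∀ m, m ≤ k → InAx L m (Λs m) U₀ (mgauge U₀ (uTower L hL k (Λs k) U₀ U₁) U₁ * U₀) := by
  -- downward induction on `k − m`
  suffices h : ∀ t m : ℕ, m + t = k → InAx L m (Λs m) U₀ (mgauge U₀ (uTower L hL k (Λs k) U₀ U₁) U₁ * U₀) by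
    intro m hm
    exact h (k - m) m (by omega)
  intro t
  induction t with
  | zero =>
    intro m hm
    rw [Nat.add_zero] at hm
    subst hm
    exact inAx_uTower_top
  | succ t ih =>
    intro m hm
    have hmk : m < k := by omega
    exact inAx_truncate (hlt m hmk) (htop m hmk) (ih (m + 1) (by omega))

end Tower

/-! ## §4 At NODE 00's carrier `zdGF3`: the `Pert`-valued map `toAxialTower` and the whole (1.144)-clause of Proposition 7's conclusion -/

section Carrier

variable (𝔸 : Type) [CStarAlgebra 𝔸] [Nontrivial 𝔸] (L : ℕ) (β : ℝ) (len : Site d → ℝ)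

open Classical in
/-- **PROPOSITION 7's MAP `(U₀, U₁) ↦ (U₀, U′)`, `U′U₀ = (U₁U₀)^{u}`, WITH `u` PRINT'S TOWER-WISE GAUGE FIXING `uTower`** (built on the member's full
listed family `i.Λs i.k`), read at the carrier `zdGF3` in the moving frame (1.17) (`U′ = U₁^{u}`, `B7Eq92Concrete.mgauge`); totalised by cases
on the unitarity of `uTower` (the small-field regime) exactly as g4's `toAxialGlev` — the unperturbed pair off the regime (junk by construction).
[cite: Balaban1985RegularSpaces, Prop. 7 (1.144) p.100, (1.17) p.78, (1.19) p.79; Balaban1985Averaging, (55) p.27, (76)–(77) pp.29–30, (87) p.31] -/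
def toAxialTower (hL1 : 1 ≤ L) :
    ∀ i : ZdIdx d L, (zdGF3 𝔸 L β len i).Cfg → (zdGF3 𝔸 L β len i).Pert → (zdGF3 𝔸 L β len i).Pert :=
  fun i U₀ P =>
    if h : ∀ x, uTower L hL1 i.k (i.Λs i.k) U₀.1 P.2.1 x ∈ unitaryUnits 𝔸 then
      (U₀, ⟨mgauge U₀.1 (uTower L hL1 i.k (i.Λs i.k) U₀.1 P.2.1) P.2.1, mgauge_mem_unitaryUnits U₀.2 P.2.2 h⟩)
    else unitPert 𝔸 L β len i U₀

variable {𝔸 L β len}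

omit [Nontrivial 𝔸] in
/-- `toAxialTower` in the regime where `uTower` is `U(𝔸)`-valued: the pair `(U₀, U₁^{uTower})`. [cite: Balaban1985RegularSpaces, (1.144) p.100 (bookkeeping)] -/
theorem toAxialTower_of_unitary (hL1 : 1 ≤ L) (i : ZdIdx d L) (U₀ : (zdGF3 𝔸 L β len i).Cfg) (P : (zdGF3 𝔸 L β len i).Pert)
    (h : ∀ x, uTower L hL1 i.k (i.Λs i.k) U₀.1 P.2.1 x ∈ unitaryUnits 𝔸) :
    toAxialTower 𝔸 L β len hL1 i U₀ P =
      (U₀, ⟨mgauge U₀.1 (uTower L hL1 i.k (i.Λs i.k) U₀.1 P.2.1) P.2.1, mgauge_mem_unitaryUnits U₀.2 P.2.2 h⟩) :=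
  dif_pos h

/-- **THE WHOLE (1.144)-CLAUSE OF PROPOSITION 7's CONCLUSION FOR PRINT'S TOWER-WISE MAP**, at a member with `Ω₀ = ℤᵈ` obeying NODE 00's located
index law №8, wherever `uTower` is `U(𝔸)`-valued: `(zdGF3 …).InAAx (α₀ + 3α₂) U₀ (toAxialTower … U₀ P)` = «background unchanged» ∧
«(U₁U₀)^{u} ∈ 𝔄_k({Ω_j}, α₀ + 3α₂)» (g4's `inAk_gaugeAct_of_c140`: the carrier's (1.139)∕(1.140) at `α₀, α₂ ≤ 1∕(80d)`, ANY unitary `u`) ∧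
«(U₁U₀)^{u} ∈ Ax_m(Λs m, U₀)` for every truncation `m ≤ k` (`inAx_uTower_all`).
[cite: Balaban1985RegularSpaces, Prop. 7 (1.144) p.100, (1.139)–(1.140) p.100, (1.34) p.82, (1.19) p.79] -/
theorem inAAx_toAxialTower (hd2 : 2 ≤ d) (hL : 1 ≤ L) (i : ZdIdx d L) (hΩ0 : i.Ω 0 = Set.univ)
    (hlt : ∀ m, m < i.k → ∀ j, j < m → i.Λs m j = i.Λs (m + 1) j)
    (htop : ∀ m, m < i.k → ∀ x, x ∈ i.Λs m m ↔ x ∈ i.Λs (m + 1) m ∨ ∃ y ∈ i.Λs (m + 1) (m + 1), x ∈ Literature.MathematicalPhysics.QuantumLattice.blockSites L y)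
    {α₀ α₂ : ℝ} (hα₀ : 0 < α₀) (hα₀c : α₀ ≤ 1 / (80 * d)) (hα₂ : 0 < α₂) (hα₂c : α₂ ≤ 1 / (80 * d))
    (U₀ : (zdGF3 𝔸 L β len i).Cfg) (P : (zdGF3 𝔸 L β len i).Pert)
    (hInA : (zdGF3 𝔸 L β len i).InA α₀ U₀) (h140 : (zdGF3 𝔸 L β len i).C140 α₂ U₀ P)
    (h : ∀ x, uTower L hL i.k (i.Λs i.k) U₀.1 P.2.1 x ∈ unitaryUnits 𝔸) :
    (zdGF3 𝔸 L β len i).InAAx (α₀ + 3 * α₂) U₀ (toAxialTower 𝔸 L β len hL i U₀ P) := by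
  rw [toAxialTower_of_unitary hL i U₀ P h]
  refine ⟨rfl, ?_, fun m hm => ?_⟩
  · show InAk L i.k i.η (α₀ + 3 * α₂) i.Ω (mulCfg (mgauge U₀.1 (uTower L hL i.k (i.Λs i.k) U₀.1 P.2.1) P.2.1) U₀.1)
    rw [mulCfg_eq_mul, mgauge_mul_eq_gaugeAct_mulCfg]
    exact inAk_gaugeAct_of_c140 hd2 hL i hΩ0 hα₀ hα₀c hα₂ hα₂c U₀ P hInA h140 h
  · show InAx L m (i.Λs m) U₀.1 (mulCfg (mgauge U₀.1 (uTower L hL i.k (i.Λs i.k) U₀.1 P.2.1) P.2.1) U₀.1)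
    rw [mulCfg_eq_mul]
    exact inAx_uTower_all hlt htop m hm

end Carrier

#print axioms inAx_uTower_top
#print axioms inAAx_toAxialTower

end Literature.MathematicalPhysics.QuantumFieldTheory.Balaban1983to89.B8Prop7TowerAxialZd3

end
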